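import Literature.Computability.AlgebraicComplexity.BIPNoOccurrence
import Literature.Computability.AlgebraicComplexity.BIPPaddingDegenerationsProofs
import Literature.Computability.AlgebraicComplexity.GCTObstructionsWeightForm
import Literature.Computability.Complexity.OccurrenceObstructionsModuleForm
import HarnessLib

/-!
# No occurrence obstructions for the fresh-variable padding, module form:
# discharge of `bip_no_occurrence_obstruction_succ`

Topic `Literature/Computability/AlgebraicComplexity`, sibling proof file (D-0014) of
`BIPNoOccurrence.lean`, whose named fact `bip_no_occurrence_obstruction_succ` is the COROLLARY form
of Bürgisser–Ikenmeyer–Panova's theorem for the tree's fresh-variable padded permanent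
`paddedPerPoly ℂ m n = X₀₀^{n-m} · per_m(bottom-right block)` (letters of that file: permanent `m`,
determinant `n`): for `1 ≤ m`, `1 ≤ d`, `(m+1)^25 ≤ n` there is no occurrence obstruction
(`HasOccurrenceObstruction`, `GCTObstructions.lean`) against `paddedPerPoly ℂ m n ∈ Δ[det_n]` in
degree `d`. Theorems only; no statement of the tree is changed.

Source: P. Bürgisser, C. Ikenmeyer, G. Panova, *No occurrence obstructions in geometric complexity
theory*, J. Amer. Math. Soc. 32 (2019) 163–193 = arXiv:1604.06431v3, Thm. 1.4 ("Let `n, d, m` be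
positive integers with `n ≥ m^25` and `λ ⊢ nd`. If `λ` occurs in `ℂ[Z_{n,m}]`, then `λ` also
occurs in `ℂ[Ω_n]`."), §1(a) (the padding convention and "Schur's lemma implies …"), and §6
"Proof of Theorem 1.4" (which, run with BIP's parameter `m := m + 1`, covers the fresh padding).

## Two derivations, both from theorems of the tree

* (this file's proof) the WEIGHT form at threshold `(m+1)^25` for the fresh padding,
  `Literature.Computability.Complexity.no_occurrence_obstructions_succ_holds`
  (`OccurrenceObstructionsDischarge.lean`: BIP §6 with `M = m + 1` on the discharged Props. 2.4,
  6.1, 6.3, Thms. 2.1, 2.5, 6.2, Lemma 2.2), turned into the module form by the bridge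
  `not_hasOccurrenceObstruction_of_forall_hasHighestWeight` (`GCTObstructionsWeightForm.lean`:
  Lie–Kolchin, a weight pins the degree, complete reducibility, theorem of the highest weight) in
  the lexicographic matrix variables `MatIdx n`, and transported to the product variables
  `Fin n × Fin n` (`Literature.Computability.Complexity.hasOccurrenceObstruction_rename_toLex_iff`);
* (recorded as `not_hasOccurrenceObstruction_paddedPerPoly_of_succ_holds`) BIP's theorem AS PRINTED
  in module form, `Literature.Computability.Complexity.bip2019_not_hasOccurrenceObstruction_holds`
  (`OccurrenceObstructionsModuleForm.lean`), at permanent size `m + 1`, and the monotonicity of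
  occurrence obstructions under the degeneration `paddedPerPoly ℂ m n ∈ Z_{n,m+1}`
  (`not_hasOccurrenceObstruction_paddedPerPoly_of_succ_of_bip`, `BIPPaddingDegenerationsProofs.lean`).

Hence `bip_no_occurrence_obstruction_succ_holds` and the unconditional form
`not_hasOccurrenceObstruction_succ_pow_holds` of the route-shaped corollary
`not_hasOccurrenceObstruction_succ_pow` of `BIPNoOccurrence.lean`. Trust base: the axiom whitelist.

## References

* P. Bürgisser, C. Ikenmeyer, G. Panova, J. AMS 32 (2019) 163–193 = arXiv:1604.06431v3: §1(a),
  Thm. 1.4, §6 (Proof of Theorem 1.4). [key `BurgisserIkenmeyerPanovaJAMS2019`;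
  `BurgisserIkenmeyerPanova2019` denotes the same paper in `BIPNoOccurrence.lean`]

## Tree

`bip_no_occurrence_obstruction_succ`, `not_hasOccurrenceObstruction_succ_pow`
(`BIPNoOccurrence.lean`); `no_occurrence_obstructions_succ_holds`
(`OccurrenceObstructionsDischarge.lean`); `not_hasOccurrenceObstruction_of_forall_hasHighestWeight`
(`GCTObstructionsWeightForm.lean`); `hasOccurrenceObstruction_rename_toLex_iff`,
`bip2019_not_hasOccurrenceObstruction_holds` (`OccurrenceObstructionsModuleForm.lean`);
`not_hasOccurrenceObstruction_paddedPerPoly_of_succ_of_bip` (`BIPPaddingDegenerationsProofs.lean`);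
`detFormLex`, `paddedPerFormLex`, `paddedPerOrbitRep`, `detOrbitRep` (`SchurWeylPlethysm.lean`).
-/

noncomputable section

namespace Literature.Computability.AlgebraicComplexity

open MvPolynomial Literature.NumberTheory.DiophantineGeometry

/-- **Discharge of `bip_no_occurrence_obstruction_succ`** (corollary of Bürgisser–Ikenmeyer–Panova
2019, Thm. 1.4, for the fresh-variable padding at threshold `(m+1)^25`): for `(m+1)^25 ≤ n` there
is no occurrence obstruction against `paddedPerPoly ℂ m n ∈ Δ[det_n]` in any degree `d` — no
irreducible `GL_{n²}(ℂ)`-subrepresentation of `ℂ[Z]_d` without a nonzero intertwiner to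
`ℂ[Ω_n]_d`. From the weight form `no_occurrence_obstructions_succ_holds` (BIP §6 run with
`M = m + 1`) by the bridge `not_hasOccurrenceObstruction_of_forall_hasHighestWeight` in the
lexicographic matrix variables, transported along `toLex`. (The hypotheses `1 ≤ m`, `1 ≤ d` of
the fact are not needed.)
[cite: BurgisserIkenmeyerPanovaJAMS2019, Thm. 1.4 applied at m+1, with §1(a) and §6 (Proof of Theorem 1.4)] -/
theorem bip_no_occurrence_obstruction_succ_holds : bip_no_occurrence_obstruction_succ := by
  intro m n d _ _hm _hd hmn
  have key : ¬ HasOccurrenceObstruction (σ := MatIdx n) (detFormLex ℂ n) (paddedPerFormLex ℂ m n)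
      n d :=
    not_hasOccurrenceObstruction_of_forall_hasHighestWeight (NeZero.ne n)
      (fun χ hχ => Literature.Computability.Complexity.no_occurrence_obstructions_succ_holds m n hmn
        χ hχ) d
  rwa [detFormLex, paddedPerFormLex,
    Literature.Computability.Complexity.hasOccurrenceObstruction_rename_toLex_iff] at key

/-- **The same statement by the second route, unconditionally**: BIP's theorem as printed in
module form (`bip2019_not_hasOccurrenceObstruction_holds`) at permanent size `m + 1`, and the
proved monotonicity of occurrence obstructions under the degeneration
`paddedPerPoly ℂ m n ∈ Z_{n,m+1}` (`not_hasOccurrenceObstruction_paddedPerPoly_of_succ_of_bip`):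
for `1 ≤ d` and `(m+1)^25 ≤ n`, no occurrence obstruction against
`paddedPerPoly ℂ m n ∈ Δ[det_n]` in degree `d`.
[cite: BurgisserIkenmeyerPanovaJAMS2019, Thm. 1.4 applied at m+1, with §1(a)] -/
theorem not_hasOccurrenceObstruction_paddedPerPoly_of_succ_holds (m n d : ℕ) [NeZero n]
    (hd : 1 ≤ d) (hn : (m + 1) ^ 25 ≤ n) :
    ¬ HasOccurrenceObstruction (detPoly (Fin n) ℂ) (paddedPerPoly ℂ m n) n d :=
  not_hasOccurrenceObstruction_paddedPerPoly_of_succ_of_bip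
    Literature.Computability.Complexity.bip2019_not_hasOccurrenceObstruction_holds m n d hd hn

/-- **The barrier in the shape the `GCTMult` route consumes, unconditionally**: at
`n = (m+1)^25` (any `m ≥ 1`) occurrence obstructions against the fresh-variable padded permanent
are absent in every degree `d ≥ 1` (`not_hasOccurrenceObstruction_succ_pow` of
`BIPNoOccurrence.lean` fed with the discharge), so an occurrence-based proof of
`dc̄(per_m) > (m+1)^25` is impossible. [cite: BurgisserIkenmeyerPanovaJAMS2019, Thm. 1.4 applied at m+1] -/
theorem not_hasOccurrenceObstruction_succ_pow_holds {m : ℕ} (hm : 1 ≤ m) {d : ℕ} (hd : 1 ≤ d) :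
    ¬ HasOccurrenceObstruction (detPoly (Fin ((m + 1) ^ 25)) ℂ) (paddedPerPoly ℂ m ((m + 1) ^ 25))
      ((m + 1) ^ 25) d :=
  not_hasOccurrenceObstruction_succ_pow bip_no_occurrence_obstruction_succ_holds hm hd

end Literature.Computability.AlgebraicComplexity
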